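import Literature.Computability.AlgebraicComplexity.SymmetricArithCircuit
import Mathlib.Algebra.MvPolynomial.Eval
import Mathlib.Data.Fintype.Card
import Mathlib.Data.Fintype.Sum
import HarnessLib

/-!
# Symmetric circuits: substitution (composition) of two symmetric circuits

Topic `Computability/AlgebraicComplexity`, namespace `Literature.Computability.AlgebraicComplexity`.

A closure property of Dawar–Wilsenach symmetric arithmetic circuits
(`SymmetricArithCircuit.lean`: `LabelledArithCircuit` = Def. 2.2, `IsAutomorphismExtending` =
Def. 3.6, `IsSymmetric` = Def. 3.7 of A. Dawar, G. Wilsenach, *Symmetric Arithmetic Circuits*,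
Theory of Computing 21 (2025)): if a `Γ`-symmetric circuit `C₁` over the variables `X` computes a
family `(g_{x'})_{x' ∈ X'}` at outputs indexed by a `Γ`-set `X'`, and a `Γ`-symmetric circuit `C₂`
over the VARIABLES `X'` computes `(h_y)_{y ∈ Y}`, then the substituted family
`(h_y(x' ↦ g_{x'}))_{y ∈ Y}` (`MvPolynomial.aeval`) is computed by a `Γ`-symmetric circuit over `X`
on exactly `|G₁| + |G₂|` gates (`LabelledArithCircuit.IsSymmetric.exists_substitution`). This is
the infrastructure behind "symmetrically computable families are closed under equivariant
substitution" (scaling of the inputs, products of equivariant matrices, determinants of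
equivariant matrices via Le Verrier, …).

Construction (`LabelledArithCircuit.Substitution.compose`): gate set `G₁ ⊕ G₂`; the gates of `C₁`
keep their wires and labels; a gate of `C₂` labelled by the VARIABLE `x'` becomes a unary `+` gate
whose only child is the output gate of `C₁` indexed `x'` (so its value becomes `g_{x'}`); a gate of
`C₂` labelled by a CONSTANT `c` that already labels a (necessarily unique, input) gate of `C₁` — its
SOURCE — becomes a unary `+` gate over the source (Def. 2.2 demands injective labels on input gates);
every other gate of `C₂` keeps its label and wires. An automorphism pair `(π₁, π₂)` extending `γ`
acts as `π₁ ⊕ π₂` (`Equiv.sumCongr`): the output gate `x'` of `C₁` goes to the output gate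
`γ • x'`, which is exactly where `π₂` sends the variable gate `x'` of `C₂`; constants are fixed.
Everything is folklore and proved; nothing here is a named fact.
-/

noncomputable section

open scoped Classical

namespace Literature.Computability.AlgebraicComplexity

open MvPolynomial

universe u v v' w₁ w₂

namespace LabelledArithCircuit

namespace Substitution

variable {K : Type u} {X : Type v} {X' : Type v'} {Y : Type*} {G₁ : Type w₁} {G₂ : Type w₂}
  (C₁ : LabelledArithCircuit K X X' G₁) (C₂ : LabelledArithCircuit K X' Y G₂)

/-! ### Duplicated constant gates and their sources -/

/-- A gate of the outer circuit `C₂` is a DUPLICATED CONSTANT if it is labelled by a constant `c`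
that already labels some gate of the inner circuit `C₁` (Def. 2.2 forbids two input gates with
the same label in one circuit). [cite: DawarWilsenach2025, Def. 2.2] -/
def IsShared (g₂ : G₂) : Prop := ∃ c : K, C₂.label g₂ = .const c ∧ ∃ g₁, C₁.label g₁ = .const c

variable {C₁ C₂}

/-- The SOURCE of a duplicated constant gate: the gate of `C₁` carrying the same constant.
[cite: DawarWilsenach2025, Def. 2.2] -/
def source {g₂ : G₂} (h : IsShared C₁ C₂ g₂) : G₁ := h.choose_spec.2.choose

/-- The source carries the same constant label (transported from `X'`-labels to `X`-labels, which
for constants is the identity). [cite: DawarWilsenach2025, Def. 2.2] -/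
theorem label_source {g₂ : G₂} (h : IsShared C₁ C₂ g₂) :
    C₁.label (source h) = .const h.choose ∧ C₂.label g₂ = .const h.choose :=
  ⟨h.choose_spec.2.choose_spec, h.choose_spec.1⟩

/-- The source is an input gate. [cite: DawarWilsenach2025, Def. 2.2] -/
theorem isInput_label_source {g₂ : G₂} (h : IsShared C₁ C₂ g₂) : (C₁.label (source h)).IsInput := by
  rw [(label_source h).1]; exact CircuitLabel.isInput_const _

/-- A duplicated gate is a constant gate. [cite: DawarWilsenach2025, Def. 2.2] -/
theorem IsShared.exists_eq_const {g₂ : G₂} (h : IsShared C₁ C₂ g₂) : ∃ c, C₂.label g₂ = .const c :=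
  ⟨h.choose, h.choose_spec.1⟩

variable (C₁ C₂)

/-! ### The construction -/

/-- Children in the substituted circuit: a gate of `C₁` keeps its children; a variable gate `x'`
of `C₂` gets the single child "output `x'` of `C₁`"; a duplicated constant gate gets its source as
only child; any other gate of `C₂` keeps its old children. [cite: DawarWilsenach2025, Def. 2.2] -/
def wires : G₁ ⊕ G₂ → Finset (G₁ ⊕ G₂)
  | .inl g₁ => (C₁.children g₁).map Function.Embedding.inl
  | .inr g₂ =>
    match C₂.label g₂ with
    | .var x' => {Sum.inl (C₁.output x')}
    | _ =>
      if h : IsShared C₁ C₂ g₂ then {Sum.inl (source h)}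
      else (C₂.children g₂).map Function.Embedding.inr

/-- Labels in the substituted circuit: old labels for `C₁`; a variable gate and a duplicated
constant gate of `C₂` become (unary) addition gates; the other gates of `C₂` keep their labels
(`+`, `×`, or a fresh constant). [cite: DawarWilsenach2025, Def. 2.2] -/
def relabel : G₁ ⊕ G₂ → CircuitLabel K X
  | .inl g₁ => C₁.label g₁
  | .inr g₂ =>
    match C₂.label g₂ with
    | .var _ => .add
    | .const c => if IsShared C₁ C₂ g₂ then .add else .const c
    | .add => .add
    | .mul => .mul

/-- Children of a gate coming from `C₁`. [cite: DawarWilsenach2025, Def. 2.2] -/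
theorem wires_inl (g₁ : G₁) :
    wires C₁ C₂ (.inl g₁) = (C₁.children g₁).map Function.Embedding.inl := rfl

/-- Label of a gate coming from `C₁`. [cite: DawarWilsenach2025, Def. 2.2] -/
theorem relabel_inl (g₁ : G₁) : relabel C₁ C₂ (.inl g₁) = C₁.label g₁ := rfl

variable {C₁ C₂}

/-- Children of a variable gate of `C₂`: the corresponding output gate of `C₁`.
[cite: DawarWilsenach2025, Def. 2.2] -/
theorem wires_inr_of_var {g₂ : G₂} {x' : X'} (hl : C₂.label g₂ = .var x') :
    wires C₁ C₂ (.inr g₂) = {Sum.inl (C₁.output x')} := by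
  simp only [wires, hl]

/-- Label of a variable gate of `C₂`: `+`. [cite: DawarWilsenach2025, Def. 2.2] -/
theorem relabel_inr_of_var {g₂ : G₂} {x' : X'} (hl : C₂.label g₂ = .var x') :
    relabel C₁ C₂ (.inr g₂) = .add := by
  simp only [relabel, hl]

/-- Children of a duplicated constant gate: its source. [cite: DawarWilsenach2025, Def. 2.2] -/
theorem wires_inr_of_shared {g₂ : G₂} (h : IsShared C₁ C₂ g₂) :
    wires C₁ C₂ (.inr g₂) = {Sum.inl (source h)} := by
  obtain ⟨c, hc⟩ := h.exists_eq_const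
  simp only [wires, hc, dif_pos h]

/-- Label of a duplicated constant gate: `+`. [cite: DawarWilsenach2025, Def. 2.2] -/
theorem relabel_inr_of_shared {g₂ : G₂} (h : IsShared C₁ C₂ g₂) : relabel C₁ C₂ (.inr g₂) = .add := by
  obtain ⟨c, hc⟩ := h.exists_eq_const
  simp only [relabel, hc, if_pos h]

/-- Children of a non-duplicated constant gate: none. [cite: DawarWilsenach2025, Def. 2.2] -/
theorem wires_inr_of_const {g₂ : G₂} {c : K} (hl : C₂.label g₂ = .const c)
    (h : ¬ IsShared C₁ C₂ g₂) :
    wires C₁ C₂ (.inr g₂) = (C₂.children g₂).map Function.Embedding.inr := by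
  simp only [wires, hl, dif_neg h]

/-- Label of a non-duplicated constant gate: the same constant. [cite: DawarWilsenach2025, Def. 2.2] -/
theorem relabel_inr_of_const {g₂ : G₂} {c : K} (hl : C₂.label g₂ = .const c)
    (h : ¬ IsShared C₁ C₂ g₂) : relabel C₁ C₂ (.inr g₂) = .const c := by
  simp only [relabel, hl, if_neg h]

/-- An addition gate of `C₂` is not duplicated. [cite: DawarWilsenach2025, Def. 2.2] -/
theorem not_isShared_of_add {g₂ : G₂} (hl : C₂.label g₂ = .add) : ¬ IsShared C₁ C₂ g₂ := by
  rintro ⟨c, hc, -⟩; rw [hl] at hc; cases hc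

/-- A multiplication gate of `C₂` is not duplicated. [cite: DawarWilsenach2025, Def. 2.2] -/
theorem not_isShared_of_mul {g₂ : G₂} (hl : C₂.label g₂ = .mul) : ¬ IsShared C₁ C₂ g₂ := by
  rintro ⟨c, hc, -⟩; rw [hl] at hc; cases hc

/-- A variable gate of `C₂` is not duplicated. [cite: DawarWilsenach2025, Def. 2.2] -/
theorem not_isShared_of_var {g₂ : G₂} {x' : X'} (hl : C₂.label g₂ = .var x') : ¬ IsShared C₁ C₂ g₂ := by
  rintro ⟨c, hc, -⟩; rw [hl] at hc; cases hc

/-- Children of an addition gate of `C₂`: its old children. [cite: DawarWilsenach2025, Def. 2.2] -/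
theorem wires_inr_of_add {g₂ : G₂} (hl : C₂.label g₂ = .add) :
    wires C₁ C₂ (.inr g₂) = (C₂.children g₂).map Function.Embedding.inr := by
  simp only [wires, hl, dif_neg (not_isShared_of_add hl)]

/-- Label of an addition gate of `C₂`: `+`. [cite: DawarWilsenach2025, Def. 2.2] -/
theorem relabel_inr_of_add {g₂ : G₂} (hl : C₂.label g₂ = .add) : relabel C₁ C₂ (.inr g₂) = .add := by
  simp only [relabel, hl]

/-- Children of a multiplication gate of `C₂`: its old children. [cite: DawarWilsenach2025, Def. 2.2] -/
theorem wires_inr_of_mul {g₂ : G₂} (hl : C₂.label g₂ = .mul) :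
    wires C₁ C₂ (.inr g₂) = (C₂.children g₂).map Function.Embedding.inr := by
  simp only [wires, hl, dif_neg (not_isShared_of_mul hl)]

/-- Label of a multiplication gate of `C₂`: `×`. [cite: DawarWilsenach2025, Def. 2.2] -/
theorem relabel_inr_of_mul {g₂ : G₂} (hl : C₂.label g₂ = .mul) : relabel C₁ C₂ (.inr g₂) = .mul := by
  simp only [relabel, hl]

/-- The only input gates coming from `C₂` are the non-duplicated constant gates.
[cite: DawarWilsenach2025, Def. 2.2] -/
theorem isInput_relabel_inr_iff (g₂ : G₂) :
    (relabel C₁ C₂ (.inr g₂)).IsInput ↔ (∃ c, C₂.label g₂ = .const c) ∧ ¬ IsShared C₁ C₂ g₂ := by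
  rcases hl : C₂.label g₂ with x' | c | _ | _
  · rw [relabel_inr_of_var hl]
    simp only [CircuitLabel.not_isInput_add, false_iff, not_and]
    rintro ⟨c, hc⟩; cases hc
  · by_cases hd : IsShared C₁ C₂ g₂
    · rw [relabel_inr_of_shared hd]
      simp only [CircuitLabel.not_isInput_add, false_iff, not_and, not_not]
      exact fun _ => hd
    · rw [relabel_inr_of_const hl hd]
      simp only [CircuitLabel.isInput_const, true_iff]
      exact ⟨⟨c, rfl⟩, hd⟩
  · rw [relabel_inr_of_add hl]
    simp only [CircuitLabel.not_isInput_add, false_iff, not_and]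
    rintro ⟨c, hc⟩; cases hc
  · rw [relabel_inr_of_mul hl]
    simp only [CircuitLabel.not_isInput_mul, false_iff, not_and]
    rintro ⟨c, hc⟩; cases hc

/-! #### Acyclicity -/

/-- Gates coming from `C₁` are accessible (acyclicity of `C₁`). [cite: DawarWilsenach2025, Def. 2.2] -/
theorem acc_inl (g₁ : G₁) : Acc (fun a b : G₁ ⊕ G₂ => a ∈ wires C₁ C₂ b) (.inl g₁) := by
  induction g₁ using C₁.wf.induction with
  | h g ih =>
    refine Acc.intro _ fun a ha => ?_
    simp only [wires, Finset.mem_map, Function.Embedding.inl_apply] at ha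
    obtain ⟨h, hh, rfl⟩ := ha
    exact ih h hh

/-- Gates coming from `C₂` are accessible (acyclicity of `C₂`; output gates of `C₁` and sources
are accessible). [cite: DawarWilsenach2025, Def. 2.2] -/
theorem acc_inr (g₂ : G₂) : Acc (fun a b : G₁ ⊕ G₂ => a ∈ wires C₁ C₂ b) (.inr g₂) := by
  induction g₂ using C₂.wf.induction with
  | h g ih =>
    refine Acc.intro _ fun a ha => ?_
    rcases hl : C₂.label g with x' | c | _ | _
    · rw [wires_inr_of_var hl, Finset.mem_singleton] at ha
      rw [ha]; exact acc_inl _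
    · by_cases hd : IsShared C₁ C₂ g
      · rw [wires_inr_of_shared hd, Finset.mem_singleton] at ha
        rw [ha]; exact acc_inl _
      · simp only [wires_inr_of_const hl hd, Finset.mem_map, Function.Embedding.inr_apply] at ha
        obtain ⟨h, hh, rfl⟩ := ha
        exact ih h hh
    · simp only [wires_inr_of_add hl, Finset.mem_map, Function.Embedding.inr_apply] at ha
      obtain ⟨h, hh, rfl⟩ := ha
      exact ih h hh
    · simp only [wires_inr_of_mul hl, Finset.mem_map, Function.Embedding.inr_apply] at ha
      obtain ⟨h, hh, rfl⟩ := ha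
      exact ih h hh

/-- The child relation of the substituted circuit is well founded. [cite: DawarWilsenach2025, Def. 2.2] -/
theorem wf : WellFounded fun a b : G₁ ⊕ G₂ => a ∈ wires C₁ C₂ b :=
  ⟨fun a => match a with
    | .inl g₁ => acc_inl g₁
    | .inr g₂ => acc_inr g₂⟩

/-! #### The labelled circuit -/

/-- Input labels exactly at the gates without children. [cite: DawarWilsenach2025, Def. 2.2] -/
theorem isInput_iff (a : G₁ ⊕ G₂) : (relabel C₁ C₂ a).IsInput ↔ wires C₁ C₂ a = ∅ := by
  cases a with
  | inl g₁ => simp only [relabel, wires, Finset.map_eq_empty]; exact C₁.isInput_iff g₁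
  | inr g₂ =>
    rw [isInput_relabel_inr_iff]
    rcases hl : C₂.label g₂ with x' | c | _ | _
    · simp only [wires_inr_of_var hl, Finset.singleton_ne_empty, iff_false, not_and]
      rintro ⟨c, hc⟩; cases hc
    · by_cases hd : IsShared C₁ C₂ g₂
      · simp only [wires_inr_of_shared hd, Finset.singleton_ne_empty, iff_false, not_and,
          not_not]
        exact fun _ => hd
      · simp only [wires_inr_of_const hl hd, Finset.map_eq_empty, hd, not_false_eq_true,
          and_true]
        have := (C₂.isInput_iff g₂).1 (by rw [hl]; exact CircuitLabel.isInput_const c)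
        simp only [this, iff_true]
        exact ⟨c, rfl⟩
    · simp only [wires_inr_of_add hl, Finset.map_eq_empty]
      have : ¬ C₂.children g₂ = ∅ := fun h0 =>
        CircuitLabel.not_isInput_add (K := K) (X := X') (hl ▸ (C₂.isInput_iff g₂).2 h0)
      simp only [this, iff_false, not_and]
      rintro ⟨c, hc⟩; cases hc
    · simp only [wires_inr_of_mul hl, Finset.map_eq_empty]
      have : ¬ C₂.children g₂ = ∅ := fun h0 =>
        CircuitLabel.not_isInput_mul (K := K) (X := X') (hl ▸ (C₂.isInput_iff g₂).2 h0)
      simp only [this, iff_false, not_and]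
      rintro ⟨c, hc⟩; cases hc

/-- Labels are injective on input gates: the input gates are those of `C₁` and the
non-duplicated constant gates of `C₂`, whose constants are, by definition, not labels of `C₁`.
[cite: DawarWilsenach2025, Def. 2.2] -/
theorem eq_of_label_eq (a b : G₁ ⊕ G₂) (ha : (relabel C₁ C₂ a).IsInput)
    (hab : relabel C₁ C₂ a = relabel C₁ C₂ b) : a = b := by
  cases a with
  | inl g₁ =>
    rw [relabel_inl] at ha hab
    cases b with
    | inl g₁' => exact congrArg Sum.inl (C₁.eq_of_label_eq g₁ g₁' ha hab)
    | inr g₂' =>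
      have hb : (relabel C₁ C₂ (.inr g₂')).IsInput := hab ▸ ha
      obtain ⟨⟨c, hc⟩, hd⟩ := (isInput_relabel_inr_iff g₂').1 hb
      rw [relabel_inr_of_const hc hd] at hab
      exact absurd ⟨c, hc, g₁, hab⟩ hd
  | inr g₂ =>
    obtain ⟨⟨c, hc⟩, hd⟩ := (isInput_relabel_inr_iff g₂).1 ha
    rw [relabel_inr_of_const hc hd] at hab
    cases b with
    | inl g₁' => exact absurd ⟨c, hc, g₁', hab.symm⟩ hd
    | inr g₂' =>
      have hb : (relabel C₁ C₂ (.inr g₂')).IsInput := by rw [← hab]; exact CircuitLabel.isInput_const c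
      obtain ⟨⟨c', hc'⟩, hd'⟩ := (isInput_relabel_inr_iff g₂').1 hb
      rw [relabel_inr_of_const hc' hd'] at hab
      have hcc : c = c' := by cases hab; rfl
      subst hcc
      exact congrArg Sum.inr
        (C₂.eq_of_label_eq g₂ g₂' (by rw [hc]; exact CircuitLabel.isInput_const c) (hc.trans hc'.symm))

variable (C₁ C₂)

/-- **The substituted circuit** of `C₂` after `C₁` (module docstring): gate set `G₁ ⊕ G₂`,
variables `X`, outputs those of `C₂`, the variable gates of `C₂` rewired to the output gates of
`C₁` and its duplicated constant gates to their sources. [cite: DawarWilsenach2025, Def. 2.2] -/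
def compose : LabelledArithCircuit K X Y (G₁ ⊕ G₂) where
  children := wires C₁ C₂
  label := relabel C₁ C₂
  output y := .inr (C₂.output y)
  wf := wf
  isInput_iff := isInput_iff
  eq_of_label_eq := eq_of_label_eq
  output_injective := Sum.inr_injective.comp C₂.output_injective

variable {C₁ C₂}

/-! ### Semantics -/

section Eval

variable [CommSemiring K]

/-- Gates coming from `C₁` keep their values. [cite: DawarWilsenach2025, §2 (evaluation)] -/
theorem eval_inl (g₁ : G₁) : (compose C₁ C₂).eval (.inl g₁) = C₁.eval g₁ := by
  induction g₁ using C₁.wf.induction with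
  | h g ih =>
    have hlab : (compose C₁ C₂).label (.inl g) = C₁.label g := rfl
    have hch : (compose C₁ C₂).children (.inl g) = (C₁.children g).map Function.Embedding.inl :=
      rfl
    rcases hl : C₁.label g with x | c | _ | _
    · rw [C₁.eval_of_label_var hl, (compose C₁ C₂).eval_of_label_var (hlab.trans hl)]
    · rw [C₁.eval_of_label_const hl, (compose C₁ C₂).eval_of_label_const (hlab.trans hl)]
    · rw [C₁.eval_of_label_add hl, (compose C₁ C₂).eval_of_label_add (hlab.trans hl), hch,
        Finset.sum_map]
      exact Finset.sum_congr rfl fun h hh => ih h hh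
    · rw [C₁.eval_of_label_mul hl, (compose C₁ C₂).eval_of_label_mul (hlab.trans hl), hch,
        Finset.prod_map]
      exact Finset.prod_congr rfl fun h hh => ih h hh

/-- **Semantics of the gates coming from `C₂`: substitution.** The value of (the copy of) a gate
of `C₂` is its old value with every variable `x'` replaced by the value of the output gate `x'`
of `C₁`. [cite: DawarWilsenach2025, §2 (evaluation)] -/
theorem eval_inr (g₂ : G₂) :
    (compose C₁ C₂).eval (.inr g₂) =
      MvPolynomial.aeval (fun x' => C₁.eval (C₁.output x')) (C₂.eval g₂) := by
  induction g₂ using C₂.wf.induction with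
  | h g ih =>
    rcases hl : C₂.label g with x' | c | _ | _
    · have hlab : (compose C₁ C₂).label (.inr g) = .add := relabel_inr_of_var hl
      have hch : (compose C₁ C₂).children (.inr g) = {Sum.inl (C₁.output x')} :=
        wires_inr_of_var hl
      rw [(compose C₁ C₂).eval_of_label_add hlab, hch, Finset.sum_singleton, eval_inl,
        C₂.eval_of_label_var hl, MvPolynomial.aeval_X]
    · by_cases hd : IsShared C₁ C₂ g
      · have hlab : (compose C₁ C₂).label (.inr g) = .add := relabel_inr_of_shared hd
        have hch : (compose C₁ C₂).children (.inr g) = {Sum.inl (source hd)} :=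
          wires_inr_of_shared hd
        obtain ⟨e1, e2⟩ := label_source hd
        have hcc : hd.choose = c := by
          have h12 := e2.symm.trans hl
          injection h12
        rw [(compose C₁ C₂).eval_of_label_add hlab, hch, Finset.sum_singleton, eval_inl,
          C₂.eval_of_label_const hl, MvPolynomial.aeval_C, MvPolynomial.algebraMap_eq,
          C₁.eval_of_label_const e1, hcc]
      · have hlab : (compose C₁ C₂).label (.inr g) = .const c := relabel_inr_of_const hl hd
        rw [(compose C₁ C₂).eval_of_label_const hlab, C₂.eval_of_label_const hl,
          MvPolynomial.aeval_C, MvPolynomial.algebraMap_eq]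
    · have hlab : (compose C₁ C₂).label (.inr g) = .add := relabel_inr_of_add hl
      have hch : (compose C₁ C₂).children (.inr g) =
          (C₂.children g).map Function.Embedding.inr := wires_inr_of_add hl
      rw [C₂.eval_of_label_add hl, (compose C₁ C₂).eval_of_label_add hlab, hch, Finset.sum_map,
        map_sum]
      exact Finset.sum_congr rfl fun h hh => ih h hh
    · have hlab : (compose C₁ C₂).label (.inr g) = .mul := relabel_inr_of_mul hl
      have hch : (compose C₁ C₂).children (.inr g) =
          (C₂.children g).map Function.Embedding.inr := wires_inr_of_mul hl
      rw [C₂.eval_of_label_mul hl, (compose C₁ C₂).eval_of_label_mul hlab, hch, Finset.prod_map,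
        map_prod]
      exact Finset.prod_congr rfl fun h hh => ih h hh

/-- **Semantics.** The output indexed `y` computes `h_y(x' ↦ g_{x'})`. [cite: DawarWilsenach2025, §2 (evaluation)] -/
theorem eval_output (y : Y) :
    (compose C₁ C₂).eval ((compose C₁ C₂).output y) =
      MvPolynomial.aeval (fun x' => C₁.eval (C₁.output x')) (C₂.eval (C₂.output y)) :=
  eval_inr (C₂.output y)

end Eval

/-! ### Symmetry -/

section Symmetry

variable {Γ : Type*} [Group Γ] [MulAction Γ X] [MulAction Γ X'] [MulAction Γ Y]
  {γ : Γ} {π₁ : Equiv.Perm G₁} {π₂ : Equiv.Perm G₂}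

/-- Along a pair of automorphisms extending `γ`, being a duplicated constant is preserved:
constant labels are fixed by `γ` (Def. 3.6) and the set of labels of `C₁` is `γ`-stable.
[cite: DawarWilsenach2025, Def. 3.6] -/
theorem isShared_apply_iff (hπ₁ : C₁.IsAutomorphismExtending γ π₁)
    (hπ₂ : C₂.IsAutomorphismExtending γ π₂) (g₂ : G₂) :
    IsShared C₁ C₂ (π₂ g₂) ↔ IsShared C₁ C₂ g₂ := by
  unfold IsShared
  rw [hπ₂.label_apply]
  constructor
  · rintro ⟨c, hc, g₁, hg₁⟩
    have hc' : C₂.label g₂ = .const c := by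
      have := congrArg (fun l => γ⁻¹ • l) hc
      simpa only [inv_smul_smul, CircuitLabel.smul_const] using this
    refine ⟨c, hc', π₁.symm g₁, ?_⟩
    have := hπ₁.label_apply (π₁.symm g₁)
    rw [Equiv.apply_symm_apply, hg₁] at this
    have := congrArg (fun l => γ⁻¹ • l) this
    simpa only [inv_smul_smul, CircuitLabel.smul_const] using this.symm
  · rintro ⟨c, hc, g₁, hg₁⟩
    exact ⟨c, by rw [hc, CircuitLabel.smul_const], π₁ g₁, by rw [hπ₁.label_apply, hg₁,
      CircuitLabel.smul_const]⟩

/-- Sources go to sources: the source of `π₂ g₂` is `π₁` of the source of `g₂` (both are constant gates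
of `C₁` with the constant of `g₂`). [cite: DawarWilsenach2025, Def. 3.6] -/
theorem source_apply (hπ₁ : C₁.IsAutomorphismExtending γ π₁)
    (hπ₂ : C₂.IsAutomorphismExtending γ π₂) {g₂ : G₂} (h : IsShared C₁ C₂ g₂)
    (h' : IsShared C₁ C₂ (π₂ g₂)) : source h' = π₁ (source h) := by
  refine C₁.eq_of_label_eq _ _ (isInput_label_source h') ?_
  obtain ⟨e1, e2⟩ := label_source h'
  obtain ⟨f1, f2⟩ := label_source h
  generalize h'.choose = c' at e1 e2
  generalize h.choose = c at f1 f2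
  rw [hπ₂.label_apply, f2, CircuitLabel.smul_const] at e2
  have hcc : c = c' := by injection e2
  rw [e1, hπ₁.label_apply, f1, CircuitLabel.smul_const, hcc]

/-- **Symmetry.** If `π₁`, `π₂` are automorphisms of `C₁`, `C₂` extending `γ` then `π₁ ⊕ π₂` is an
automorphism of the substituted circuit extending `γ`. [cite: DawarWilsenach2025, Def. 3.6] -/
theorem isAutomorphismExtending_sumCongr (hπ₁ : C₁.IsAutomorphismExtending γ π₁)
    (hπ₂ : C₂.IsAutomorphismExtending γ π₂) :
    (compose C₁ C₂).IsAutomorphismExtending γ (Equiv.sumCongr π₁ π₂) := by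
  refine ⟨?_, ?_, ?_⟩
  · rintro (g₁ | g₂)
    · change wires C₁ C₂ (.inl (π₁ g₁)) =
        (wires C₁ C₂ (.inl g₁)).map (Equiv.sumCongr π₁ π₂).toEmbedding
      rw [wires_inl, wires_inl, hπ₁.children_apply, Finset.map_map, Finset.map_map]
      rfl
    · change wires C₁ C₂ (.inr (π₂ g₂)) =
        (wires C₁ C₂ (.inr g₂)).map (Equiv.sumCongr π₁ π₂).toEmbedding
      have hlab := hπ₂.label_apply g₂
      rcases hl : C₂.label g₂ with x' | c | _ | _
      · rw [hl, CircuitLabel.smul_var] at hlab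
        rw [wires_inr_of_var hlab, wires_inr_of_var hl, Finset.map_singleton,
          hπ₁.output_smul]
        rfl
      · by_cases hd : IsShared C₁ C₂ g₂
        · have hd' : IsShared C₁ C₂ (π₂ g₂) := (isShared_apply_iff hπ₁ hπ₂ g₂).2 hd
          rw [wires_inr_of_shared hd', wires_inr_of_shared hd, Finset.map_singleton,
            source_apply hπ₁ hπ₂ hd hd']
          rfl
        · have hd' : ¬ IsShared C₁ C₂ (π₂ g₂) := fun h => hd ((isShared_apply_iff hπ₁ hπ₂ g₂).1 h)
          rw [hl, CircuitLabel.smul_const] at hlab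
          rw [wires_inr_of_const hlab hd', wires_inr_of_const hl hd, hπ₂.children_apply,
            Finset.map_map, Finset.map_map]
          rfl
      · rw [hl, CircuitLabel.smul_add] at hlab
        rw [wires_inr_of_add hlab, wires_inr_of_add hl, hπ₂.children_apply,
          Finset.map_map, Finset.map_map]
        rfl
      · rw [hl, CircuitLabel.smul_mul] at hlab
        rw [wires_inr_of_mul hlab, wires_inr_of_mul hl, hπ₂.children_apply,
          Finset.map_map, Finset.map_map]
        rfl
  · rintro (g₁ | g₂)
    · exact hπ₁.label_apply g₁
    · change relabel C₁ C₂ (.inr (π₂ g₂)) = γ • relabel C₁ C₂ (.inr g₂)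
      have hlab := hπ₂.label_apply g₂
      rcases hl : C₂.label g₂ with x' | c | _ | _
      · rw [hl, CircuitLabel.smul_var] at hlab
        rw [relabel_inr_of_var hlab, relabel_inr_of_var hl, CircuitLabel.smul_add]
      · by_cases hd : IsShared C₁ C₂ g₂
        · have hd' : IsShared C₁ C₂ (π₂ g₂) := (isShared_apply_iff hπ₁ hπ₂ g₂).2 hd
          rw [relabel_inr_of_shared hd', relabel_inr_of_shared hd, CircuitLabel.smul_add]
        · have hd' : ¬ IsShared C₁ C₂ (π₂ g₂) := fun h => hd ((isShared_apply_iff hπ₁ hπ₂ g₂).1 h)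
          rw [hl, CircuitLabel.smul_const] at hlab
          rw [relabel_inr_of_const hlab hd', relabel_inr_of_const hl hd, CircuitLabel.smul_const]
      · rw [hl, CircuitLabel.smul_add] at hlab
        rw [relabel_inr_of_add hlab, relabel_inr_of_add hl, CircuitLabel.smul_add]
      · rw [hl, CircuitLabel.smul_mul] at hlab
        rw [relabel_inr_of_mul hlab, relabel_inr_of_mul hl, CircuitLabel.smul_mul]
  · intro y
    change Sum.inr (C₂.output (γ • y)) = Sum.inr (π₂ (C₂.output y))
    rw [hπ₂.output_smul]

/-- A pair of `Γ`-symmetric circuits gives a `Γ`-symmetric substituted circuit (Def. 3.7).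
[cite: DawarWilsenach2025, Def. 3.7] -/
theorem isSymmetric (h₁ : C₁.IsSymmetric Γ) (h₂ : C₂.IsSymmetric Γ) :
    (compose C₁ C₂).IsSymmetric Γ := by
  intro γ
  obtain ⟨π₁, hπ₁⟩ := h₁ γ
  obtain ⟨π₂, hπ₂⟩ := h₂ γ
  exact ⟨Equiv.sumCongr π₁ π₂, isAutomorphismExtending_sumCongr hπ₁ hπ₂⟩

end Symmetry

end Substitution

/-- **Substitution (composition) of symmetric circuits.** For any group `Γ` acting on the
variables `X`, on the intermediate index set `X'` and on the output index set `Y`: if a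
`Γ`-symmetric circuit `C₁` over `X` computes `(g_{x'})_{x' ∈ X'}` and a `Γ`-symmetric circuit
`C₂` over the variables `X'` computes `(h_y)_{y ∈ Y}`, then `(MvPolynomial.aeval g (h_y))_{y ∈ Y}`
is computed by a `Γ`-symmetric circuit over `X` on at most `|G₁| + |G₂|` gates (Dawar–Wilsenach
Defs. 2.2, 3.6, 3.7; the construction is `Substitution.compose`). [cite: DawarWilsenach2025, Def. 3.7] -/
theorem IsSymmetric.exists_substitution {K : Type u} [CommSemiring K] {X : Type v} {X' : Type v'}
    {Y : Type*} {G₁ : Type w₁} {G₂ : Type w₂} [Fintype G₁] [Fintype G₂] {Γ : Type*} [Group Γ]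
    [MulAction Γ X] [MulAction Γ X'] [MulAction Γ Y]
    {C₁ : LabelledArithCircuit K X X' G₁} {C₂ : LabelledArithCircuit K X' Y G₂}
    (h₁ : C₁.IsSymmetric Γ) (h₂ : C₂.IsSymmetric Γ) :
    ∃ (G : Type (max w₁ w₂)) (_ : Fintype G) (C : LabelledArithCircuit K X Y G),
      C.IsSymmetric Γ ∧
      (∀ y, C.eval (C.output y) =
        MvPolynomial.aeval (fun x' => C₁.eval (C₁.output x')) (C₂.eval (C₂.output y))) ∧
      Fintype.card G ≤ Fintype.card G₁ + Fintype.card G₂ :=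
  ⟨G₁ ⊕ G₂, inferInstance, Substitution.compose C₁ C₂, Substitution.isSymmetric h₁ h₂,
    Substitution.eval_output, Fintype.card_sum.le⟩

end LabelledArithCircuit

end Literature.Computability.AlgebraicComplexity

end
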